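import Summits.Ventures.PackingBounds.ThreePointCert.CheckSym2
import Literature.Geometry.DiscreteGeometry.ThreePointKernelDimThree

/-!
# Three-point certificate checker on `S²` (`n = 3`, Chebyshev kernels; Tammes rows)

Framing: lottery ticket; floor = certified bounds/negative ranges. Venture `PackingBounds`
(cell `pub-packcert`), three-point SDP family.

`ThreePointCert.Check`/`Sound`/`Soundness` (and `CheckSym2`) handle every dimension `n ≥ 4`: the
three-point kernels are the homogeneous Gegenbauer polynomials `Q n k` of parameter `(n-3)/2`, and
their positivity around a pole is `ThreePointKernelGeneral`. On `S² ⊂ ℝ³` the parameter is `0` and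
the kernel is the homogeneous Chebyshev polynomial `BachocVallentin.Q3 k` (`= chebHom k σ π`,
`σ = 2(t-uv)`, `π = (1-u²)(1-v²)`; Bachoc–Vallentin Theorem 3.2 with `P_k^{2} = T_k`), whose
positivity is `ThreePointKernelDimThree.tripleSum_sym6_weight_nonneg3`. This file supplies the
`n = 3` three-point part of the checker and the corresponding soundness theorem; everything else
(two-point part `APolyG 3` = Legendre, `b`-matrix, the multipliers, `(i')`, `(ii')` in either
multiplier set, the bound) is reused from the general files:

* `QI3 k` — integer term list with `eval (QI3 k) = c_k · Q3 k` (`c_0 = 1`, `c_k = 2` for `k ≥ 1`;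
  recurrence `T̂_{k+2} = σ T̂_{k+1} - π T̂_k`), `Mfac3 d k` (`= W` for `k = 0`, `W/2` otherwise, so
  `Mfac3 d k · c_k = W = 2^d d!` — the same unit `D²W` as the general checker);
* `FPoly3 d bs` — reflected form of `FI = W · Fval3 bs`, `Fval3 bs = Σ_blocks Σ_w sym6(φ_w φ_w Q3 k)`;
  block-chunk check `FchunkOK3` (`residualBound`, as `FchunkOKG`);
* `PolysOK33` — validity of the expansion data (`FI` expansion w.r.t. `FPoly3` + the seven Gram
  blocks, unchanged `RValid`);
* `checkSide33` (`n = 3` instead of `n ≥ 4`). The soundness theorems (`FII33S2_of_check`,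
  `AF33_of_check`, `bound33_of_check`, `card_le_of_cert33S2`) are in `ThreePointCert.SoundDim3`:
  a checked certificate with `c.n = 3` in Bachoc–Vallentin's multiplier set (mode `sym2`,
  `checkII3S2` of `CheckSym2`) bounds every finite set of unit vectors of `ℝ³` with pairwise inner
  products `≤ p/q` by `N` — the form in which the cell's Tammes certificates
  (`A(3, s) ≤ N - 1 ⇒ θ(N) ≤ arccos s`) become kernel theorems.

## References
* C. Bachoc, F. Vallentin, New upper bounds for kissing numbers from semidefinite programming,
  J. Amer. Math. Soc. 21 (2008) 909–924, Theorems 3.2, 4.2. [`BachocVallentin2007`]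
* C. Bachoc, F. Vallentin, Semidefinite programming, multivariate orthogonal polynomials, and codes
  in spherical caps / ISIT 2007 Table 5.3 (Tammes bounds). [`BachocVallentin2007ISIT`]
-/

noncomputable section

open Finset
open scoped RealInnerProductSpace

namespace Summit.Ventures.PackingBounds.ThreePointCert

open Literature.Geometry.DiscreteGeometry Literature.Geometry.DiscreteGeometry.PolyCert
open Literature.Geometry.DiscreteGeometry.PolyCert.SPoly
open Literature.Analysis.SpecialFunctions

/-! ### The Chebyshev table -/

/-- `QI3 k`: `QI3 0 = 1`, `QI3 1 = σ`, `QI3 2 = σ² - 2π`, `QI3 (j+3) = σ·QI3 (j+2) - π·QI3 (j+1)`;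
`eval (QI3 k) = c_k · Q3 k` with `c_0 = 1`, `c_k = 2` (`k ≥ 1`). -/
def QI3 : ℕ → SPoly
  | 0 => C 1
  | 1 => sigP
  | 2 => normalize (mulN sigP sigP ++ smul (-2) piP)
  | j + 3 => normalize (mulN sigP (QI3 (j + 2)) ++ neg (mulN piP (QI3 (j + 1))))

/-- The scalar `c_k` (`1` for `k = 0`, else `2`). -/
def cfac3 (k : ℕ) : ℕ := if k = 0 then 1 else 2

/-- `Mfac3 d k = W / c_k` (`W = 2^d d!`). -/
def Mfac3 (d k : ℕ) : ℕ := if k = 0 then Wfac d else Wfac d / 2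

/-- `eval (QI3 k) = c_k · Q3 k`. -/
theorem eval_QI3 (k : ℕ) (u v t : ℝ) :
    eval (QI3 k) u v t = (cfac3 k : ℝ) * BachocVallentin.Q3 k u v t := by
  induction k using Nat.strongRecOn with
  | ind k ih =>
    match k with
    | 0 => simp [QI3, cfac3, BachocVallentin.Q3, chebHom]
    | 1 =>
      simp only [QI3, eval_sigP, cfac3, BachocVallentin.Q3, chebHom]
      push_cast; ring
    | 2 =>
      rw [QI3, eval_normalize, eval_append, eval_mulN, eval_smul, eval_sigP, eval_piP]
      simp only [cfac3, BachocVallentin.Q3, chebHom]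
      push_cast; ring
    | j + 3 =>
      have h1 := ih (j + 1) (by omega)
      have h2 := ih (j + 2) (by omega)
      rw [QI3, eval_normalize, eval_append, eval_mulN, eval_neg, eval_mulN, h1, h2, eval_sigP,
        eval_piP]
      simp only [cfac3, BachocVallentin.Q3, chebHom]
      have e1 : (j + 1 = 0) = False := by simp
      have e2 : (j + 2 = 0) = False := by simp
      have e3 : (j + 3 = 0) = False := by simp
      simp only [e1, e2, e3, if_false]
      push_cast; ring

/-- `Mfac3 d k · c_k = W` for `k ≤ d`. -/
theorem Mfac3_mul (d k : ℕ) (hk : k ≤ d) : Mfac3 d k * cfac3 k = Wfac d := by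
  unfold Mfac3 cfac3
  by_cases h : k = 0
  · simp [h]
  · simp only [h, if_false]
    have hd : 1 ≤ d := by omega
    have h2 : 2 ∣ Wfac d := by
      unfold Wfac
      exact Dvd.dvd.mul_right (dvd_pow_self 2 (by omega)) _
    exact Nat.div_mul_cancel h2

/-! ### The three-point part on `S²` -/

/-- `u^a v^b QI3 k` as a term list. -/
def baseTab3 (k a b : ℕ) : SPoly := normalize (mulN [(⟨a, b, 0⟩, 1)] (QI3 k))

/-- `sym6 (u^a v^b QI3 k)` as a term list. -/
def symTab3 (k a b : ℕ) : SPoly :=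
  normalize (baseTab3 k a b ++ permBAC (baseTab3 k a b) ++ permACB (baseTab3 k a b) ++
    permCBA (baseTab3 k a b) ++ permCAB (baseTab3 k a b) ++ permBCA (baseTab3 k a b))

/-- One weight vector: `Σ_{a,b} w_a w_b · symTab3 k a b`. -/
def FwPoly3 (k : ℕ) (w : List ℤ) : SPoly :=
  mergeAll ((List.range w.length).map fun a => mergeAll ((List.range w.length).map fun b' =>
    smul (w.getD a 0 * w.getD b' 0) (symTab3 k a b')))

/-- One block: `Mfac3 d k · Σ_w FwPoly3`. -/
def FbPoly3 (d : ℕ) (b : FBlk) : SPoly := smul (Mfac3 d b.k : ℤ) (mergeAll (b.ws.map (FwPoly3 b.k)))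

/-- Reflective form of `FI = W · Σ_blocks Σ_w sym6(φ_w φ_w Q3 k)` on `S²`. -/
def FPoly3 (d : ℕ) (bs : List FBlk) : SPoly := mergeAll (bs.map (FbPoly3 d))

/-- Block-chunk check for the `S²` three-point part: `Dprev + FPoly3 bs - Dnext ≡ 0`. -/
def FchunkOK3 (d : ℕ) (bs : List FBlk) (Dprev Dnext : SPoly) : Bool :=
  residualBound (Dprev ++ FPoly3 d bs ++ neg Dnext) 0

/-- Side conditions for an `S²` certificate: `n = 3`, `0 < q`, `-q ≤ p ≤ q`, `|A| = d+1`,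
all blocks of degree `≤ d`, `B12² ≤ B11 B22`. -/
def checkSide33 (c : Cert3) : Bool :=
  decide (c.n = 3) && decide (0 < c.q) && decide (c.p ≤ (c.q : ℤ)) && decide (-(c.q : ℤ) ≤ c.p) &&
    decide (c.A.length = c.d + 1) && (c.F.all fun b => decide (b.k ≤ c.d)) &&
    decide (c.B12 * c.B12 ≤ (c.B11 : ℤ) * (c.B22 : ℤ))

/-! ### Values -/

/-- The `Y`-form on `S²`: `φ(u) φ(v) Q3 k (u,v,t)`. -/
def Y3 (k : ℕ) (φ : ℝ → ℝ) (u v t : ℝ) : ℝ := φ u * φ v * BachocVallentin.Q3 k u v t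

/-- `F` in units of `1/D²` on `S²`: `Σ_blocks Σ_w sym6 (Y3 k φ_w)`. -/
def Fval3 (bs : List FBlk) (u v t : ℝ) : ℝ :=
  (bs.map fun b => (b.ws.map fun w => sym6 (Y3 b.k (phiW w)) u v t).sum).sum

/-- **Positivity of the `S²` three-point part** over any finite set of unit vectors of `ℝ³`
(Bachoc–Vallentin (pos S) for `n = 3`, from `ThreePointKernelDimThree`). -/
theorem tripleSum_Fval3_nonneg (bs : List FBlk)
    (C : Finset (EuclideanSpace ℝ (Fin 3))) (hC : ∀ x ∈ C, ‖x‖ = 1) :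
    0 ≤ BachocVallentin.tripleSum C (Fval3 bs) := by
  unfold Fval3
  rw [tripleSum_listSumG]
  refine List.sum_nonneg ?_
  intro x hx
  rw [List.mem_map] at hx
  obtain ⟨b, _, rfl⟩ := hx
  rw [tripleSum_listSumG]
  refine List.sum_nonneg ?_
  intro y hy
  rw [List.mem_map] at hy
  obtain ⟨w, _, rfl⟩ := hy
  exact BachocVallentin.tripleSum_sym6_weight_nonneg3 b.k (phiW w) C hC

/-- `Fval3` is symmetric in its first two arguments. -/
theorem Fval3_swap12 (bs : List FBlk) (u v t : ℝ) : Fval3 bs u v t = Fval3 bs v u t := by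
  unfold Fval3
  congr 1; refine List.map_congr_left fun b _ => ?_
  congr 1; refine List.map_congr_left fun w _ => ?_
  exact sym6_swap12 _ u v t

/-- `Fval3` is symmetric in its last two arguments. -/
theorem Fval3_swap23 (bs : List FBlk) (u v t : ℝ) : Fval3 bs u v t = Fval3 bs u t v := by
  unfold Fval3
  congr 1; refine List.map_congr_left fun b _ => ?_
  congr 1; refine List.map_congr_left fun w _ => ?_
  exact sym6_swap23 _ u v t

/-- Expansion of one weight vector: `sym6 (Y3 k φ_w) = Σ_{a,b} w_a w_b sym6 (u^a v^b Q3 k)`. -/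
theorem sym6_Y3_phiW (k : ℕ) (w : List ℤ) (u v t : ℝ) :
    sym6 (Y3 k (phiW w)) u v t = ∑ a ∈ Finset.range w.length, ∑ b ∈ Finset.range w.length,
      ((w.getD a 0 * w.getD b 0 : ℤ) : ℝ) *
        sym6 (fun u v t => u ^ a * v ^ b * BachocVallentin.Q3 k u v t) u v t := by
  have key : ∀ x y r : ℝ, phiW w x * phiW w y * r =
      ∑ a ∈ Finset.range w.length, ∑ b ∈ Finset.range w.length,
        ((w.getD a 0 * w.getD b 0 : ℤ) : ℝ) * (x ^ a * y ^ b * r) := by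
    intro x y r
    unfold phiW
    rw [Finset.sum_mul_sum, Finset.sum_mul]
    refine Finset.sum_congr rfl fun a _ => ?_
    rw [Finset.sum_mul]
    refine Finset.sum_congr rfl fun b _ => ?_
    push_cast; ring
  simp only [sym6, Y3, key, ← Finset.sum_add_distrib]
  refine Finset.sum_congr rfl fun a _ => Finset.sum_congr rfl fun b _ => ?_
  ring

/-- `eval (baseTab3 k a b) = c_k · u^a v^b Q3 k`. -/
theorem eval_baseTab3 (k a b : ℕ) (u v t : ℝ) :
    eval (baseTab3 k a b) u v t =
      (cfac3 k : ℝ) * (u ^ a * v ^ b * BachocVallentin.Q3 k u v t) := by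
  rw [baseTab3, eval_normalize, eval_mulN, eval_QI3]
  simp [eval, Mono.eval]; ring

/-- `eval (symTab3 k a b) = c_k · sym6 (u^a v^b Q3 k)`. -/
theorem eval_symTab3 (k a b : ℕ) (u v t : ℝ) :
    eval (symTab3 k a b) u v t = (cfac3 k : ℝ) *
      sym6 (fun u v t => u ^ a * v ^ b * BachocVallentin.Q3 k u v t) u v t := by
  simp only [symTab3, eval_normalize, eval_append, eval_permBAC, eval_permACB, eval_permCBA,
    eval_permCAB, eval_permBCA, eval_baseTab3, sym6]
  ring

/-- `eval (FwPoly3 k w) = c_k · sym6 (Y3 k φ_w)`. -/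
theorem eval_FwPoly3 (k : ℕ) (w : List ℤ) (u v t : ℝ) :
    eval (FwPoly3 k w) u v t = (cfac3 k : ℝ) * sym6 (Y3 k (phiW w)) u v t := by
  rw [FwPoly3, eval_mergeAll, List.map_map, sym6_Y3_phiW, Finset.mul_sum, ← list_sum_map_range]
  refine congrArg List.sum (List.map_congr_left fun a _ => ?_)
  simp only [Function.comp_apply]
  rw [eval_mergeAll, List.map_map, Finset.mul_sum, ← list_sum_map_range]
  refine congrArg List.sum (List.map_congr_left fun b' _ => ?_)
  simp only [Function.comp_apply]
  rw [eval_smul, eval_symTab3]; ring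

/-- `eval` of one block (`k ≤ d`): `W · Σ_w sym6 (Y3 k φ_w)`. -/
theorem eval_FbPoly3 (d : ℕ) (b : FBlk) (hk : b.k ≤ d) (u v t : ℝ) :
    eval (FbPoly3 d b) u v t =
      (Wfac d : ℝ) * (b.ws.map fun w => sym6 (Y3 b.k (phiW w)) u v t).sum := by
  have hW : (Mfac3 d b.k : ℝ) * (cfac3 b.k : ℝ) = (Wfac d : ℝ) := by
    exact_mod_cast Mfac3_mul d b.k hk
  rw [FbPoly3, eval_smul, eval_mergeAll, List.map_map]
  have e : (b.ws.map ((fun p => eval p u v t) ∘ FwPoly3 b.k)).sum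
      = (cfac3 b.k : ℝ) * (b.ws.map fun w => sym6 (Y3 b.k (phiW w)) u v t).sum := by
    rw [← List.sum_map_mul_left]
    exact congrArg List.sum (List.map_congr_left fun w _ => by
      simp only [Function.comp_apply, eval_FwPoly3])
  rw [e, ← mul_assoc]
  push_cast
  rw [hW]

/-- `eval (FPoly3 d bs) = W · Fval3 bs` when all blocks have degree `≤ d`. -/
theorem eval_FPoly3 (d : ℕ) (bs : List FBlk) (hk : ∀ b ∈ bs, b.k ≤ d) (u v t : ℝ) :
    eval (FPoly3 d bs) u v t = (Wfac d : ℝ) * Fval3 bs u v t := by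
  rw [FPoly3, eval_mergeAll, List.map_map, Fval3, ← List.sum_map_mul_left]
  exact congrArg List.sum (List.map_congr_left fun b hb => by
    simp only [Function.comp_apply]; rw [eval_FbPoly3 d b (hk b hb)])

/-! ### Validity of the expansion data -/

/-- Semantic validity of an `FI` expansion on `S²`: `FP = FPoly3` on the unit box. -/
def FexpValid3 (c : Cert3) (FP : SPoly) : Prop :=
  ∀ u v t : ℝ, |u| ≤ 1 → |v| ≤ 1 → |t| ≤ 1 → eval FP u v t = eval (FPoly3 c.d c.F) u v t

/-- `FPoly3` is additive in the block list (on values). -/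
theorem eval_FPoly3_append (d : ℕ) (l₁ l₂ : List FBlk) (u v t : ℝ) :
    eval (FPoly3 d (l₁ ++ l₂)) u v t = eval (FPoly3 d l₁) u v t + eval (FPoly3 d l₂) u v t := by
  simp [FPoly3, eval_mergeAll, List.map_append, List.sum_append]

/-- Block-chunk validity of the `S²` `FI` expansion on values. -/
def FChunkVal3 (c : Cert3) (bs : List FBlk) (Dprev Dnext : SPoly) : Prop :=
  ∀ u v t : ℝ, |u| ≤ 1 → |v| ≤ 1 → |t| ≤ 1 →
    eval Dnext u v t = eval Dprev u v t + eval (FPoly3 c.d bs) u v t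

/-- A kernel block-chunk check gives chunk validity. -/
theorem fchunkVal3_of_ok (c : Cert3) (bs : List FBlk) (Dprev Dnext : SPoly)
    (h : FchunkOK3 c.d bs Dprev Dnext = true) : FChunkVal3 c bs Dprev Dnext := by
  intro u v t hu hv ht
  have h0 := abs_eval_le_of_residualBound _ _ h hu hv ht
  rw [eval_append, eval_append, eval_neg] at h0
  have h1 : |Dprev.eval u v t + (FPoly3 c.d bs).eval u v t + -Dnext.eval u v t| ≤ 0 := by
    simpa using h0
  have h2 := abs_nonpos_iff.1 h1
  linarith

/-- Consecutive block chunks compose. -/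
theorem fchunkVal3_append (c : Cert3) (l₁ l₂ : List FBlk) (D0 D1 D2 : SPoly)
    (h1 : FChunkVal3 c l₁ D0 D1) (h2 : FChunkVal3 c l₂ D1 D2) : FChunkVal3 c (l₁ ++ l₂) D0 D2 := by
  intro u v t hu hv ht
  rw [h2 u v t hu hv ht, h1 u v t hu hv ht, eval_FPoly3_append]; ring

/-- Validity of the `FI` expansion from a full-range block-chunk validity. -/
theorem fexpValid3_of_fchunkVal (c : Cert3) (FP : SPoly) (bs : List FBlk) (hbs : bs = c.F)
    (h : FChunkVal3 c bs [] FP) : FexpValid3 c FP := by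
  intro u v t hu hv ht
  rw [h u v t hu hv ht, eval_nil, zero_add, hbs]

/-- Validity of all expansion data of an `S²` certificate: the `FI` expansion (w.r.t. `FPoly3`)
and the seven Gram blocks (`E0 … E4` for `(ii')`, `EQ0, EQ1` for `(i')`). -/
structure PolysOK33 (c : Cert3) (P : CertPolys3) (g0 g1 g2 g3 g4 q0 q1 : GramBlk) : Prop where
  /-- `FI` expansion valid -/
  hF : FexpValid3 c P.FP
  /-- Gram expansion for multiplier `1` of `(ii')` -/
  h0 : RValid g0 P.E0
  /-- Gram expansion for multiplier `g_q` (coset form) -/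
  h1 : RValid g1 P.E1
  /-- Gram expansion for multiplier `m₂` -/
  h2 : RValid g2 P.E2
  /-- Gram expansion for multiplier `m₃` -/
  h3 : RValid g3 P.E3
  /-- Gram expansion for multiplier `s₄` -/
  h4 : RValid g4 P.E4
  /-- Gram expansion for multiplier `1` of `(i')` -/
  hq0 : RValid q0 P.EQ0
  /-- Gram expansion for multiplier `g_q(u)` of `(i')` -/
  hq1 : RValid q1 P.EQ1

/-- The Gram part of `PolysOK33` is a `PolysOK3` for ANY `FI`-validity witness; used to call the
general right-hand-side lemmas, which never look at `hF`. -/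
theorem PolysOK33.toPolysOK3 {c : Cert3} {P : CertPolys3} {g0 g1 g2 g3 g4 q0 q1 : GramBlk}
    (hP : PolysOK33 c P g0 g1 g2 g3 g4 q0 q1) (hF : FexpValidG c P.FP) :
    PolysOK3 c P g0 g1 g2 g3 g4 q0 q1 :=
  ⟨hF, hP.h0, hP.h1, hP.h2, hP.h3, hP.h4, hP.hq0, hP.hq1⟩

/-- Unpacked side conditions (`n = 3`). -/
theorem side33_of_check (c : Cert3) (hs : checkSide33 c = true) :
    c.n = 3 ∧ 0 < c.q ∧ c.p ≤ (c.q : ℤ) ∧ -(c.q : ℤ) ≤ c.p ∧ c.A.length = c.d + 1 ∧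
      (∀ b ∈ c.F, b.k ≤ c.d) ∧ c.B12 * c.B12 ≤ (c.B11 : ℤ) * (c.B22 : ℤ) := by
  simp only [checkSide33, Bool.and_eq_true, decide_eq_true_eq, List.all_eq_true] at hs
  obtain ⟨⟨⟨⟨⟨⟨h1, h2⟩, h3⟩, h4⟩, h5⟩, h6⟩, h7⟩ := hs
  exact ⟨h1, h2, h3, h4, h5, h6, h7⟩

end Summit.Ventures.PackingBounds.ThreePointCert

end
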